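import Summits.AnomalousDissipation.AnomalousDissipation.Theses.MarginalStabilityChain
import Summits.AnomalousDissipation.AnomalousDissipation.Theses.TwoAndHalfD
import Summits.AnomalousDissipation.AnomalousDissipation.Theorems.MarginalStabilityChainChainRealisationStubLoudOfContrast
import Summits.AnomalousDissipation.AnomalousDissipation.Theorems.TwohalfdNeg.Negative.LaminarShear
import Literature.Analysis.FunctionSpaces.TorusLinearisedFormTruncation
import HarnessLib

/-!
# Negative knowledge for the crux `MarginalStabilityChain.ChainRealisation` (stmt-AnomalousDissipation-14249):
# symmetric witnesses of the residual of line `SketchIdeator2` contradict `TwoAndHalfD.TwohalfdNeg`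

Certified copy of §4 of the cdisprove work file `Cruxes/ChainRealisation/Disproof.lean`.  Supports
stmt-AnomalousDissipation-14249 (line `SketchIdeator2`, card `separatrix-flux-pinning`).

The line's residual `ContrastFamily` (`Cruxes/ChainRealisation/Lines/SketchIdeator2.lean` §3) forces the fluid by a
`2½`-DIMENSIONAL arena force `f = twoHalf g (μ • h)` — invariant under the vertical translations `x ↦ x + s e₂`.
Its witnesses `u_j` are NOT asked to share that symmetry, and this file shows they had better not: if every slice
`u_j t` is `e₂`-translation invariant (the residual restricted to the `2½`-dimensional class, stated inline),
then (i) `f` is an `x₂`-invariant smooth solenoidal mean-zero steady force, (ii) each forward classical trajectory is a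
global Leray–Hopf solution from `u_j 0` (`Torus.IsClassicalNSSolutionOn.isLerayHopfOn_of_convex`), (iii) by the landed
budget step of the line (`meanDissipation_eq_longTimeAvgSup_inner`, `mul_le_longTimeAvgSup_inner_twoHalf`: energy
equality + the contrast floor) `meanDissipation (ν j) (u j) ≥ μ a₀ > 0` at every level, while (iv) the energy ceiling
is the residual's own clause — so the family is a counterexample to `TwoAndHalfD.TwohalfdNeg` (stmt 0211: "no anomaly
for `x₂`-invariant bounded-energy Leray–Hopf families under an `x₂`-invariant steady force"), equivalently a witness of
the shape of `TwoAndHalfD.TwohalfdThesis` (stmt 0206, that route's rank-0 crux; Alexakis–Doering puts all such anomaly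
in the passive axial component).  Hence `not_contrastFamilySymm_of_twohalfdNeg : TwohalfdNeg → ¬ ContrastFamilySymm`.

Reading for the lead: modulo the open negative crux 0211 (planner: "plausible"), witnesses of the residual must BREAK
the vertical translation symmetry of the arena — the contrast floor has to be carried by genuinely three-dimensional
secondary flow (the card's separatrix layers / KH billows), never by the `2½`-dimensional (planar NS + passive axial
scalar) dynamics of the arena itself; and an `x₂`-invariant construction of the residual would be a proof of crux 0206
in disguise.  `TwohalfdNeg` is NOT constructible here (open), so this is a plain negative lemma on a sub-class of a
line-internal statement, not a refutation of anything; no new `def … : Prop` is introduced.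
-/

set_option linter.dupNamespace false

noncomputable section

namespace Summit.AnomalousDissipation.AnomalousDissipation.Theorems.ChainRealisation.Negative

open MeasureTheory Set Filter Topology
open scoped InnerProductSpace
open Literature.Analysis.FunctionSpaces Literature.Analysis.FunctionSpaces.Torus
open Literature.Analysis.FluidPDE Literature.Analysis.FluidPDE.Torus
open Summit.AnomalousDissipation.AnomalousDissipation.Theses
open Summit.AnomalousDissipation.AnomalousDissipation.Theorems.ChainRealisation.SeparatrixFluxPinning
  (meanDissipation_eq_longTimeAvgSup_inner mul_le_longTimeAvgSup_inner_twoHalf hasZeroMean_twoHalf_smul)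
open Summit.AnomalousDissipation.AnomalousDissipation.Theorems.TwohalfdNeg.Negative (not_tendsto_zero_of_le)

/-- The arena force is invariant under vertical translations (it is a planar lift). [folklore] -/
theorem twoHalf_add_single (g : (UnitAddTorus (Fin 2)) → (EuclideanSpace ℝ (Fin 2))) (k : (UnitAddTorus (Fin 2)) → ℝ) (s : UnitAddCircle) (x : (UnitAddTorus (Fin 3))) :
    twoHalf g k (x + Pi.single (2 : Fin 3) s) = twoHalf g k x := by
  rw [twoHalf_eq_comp, Function.comp_apply, Function.comp_apply]
  exact comp_planarProj_add_single (fun y => planarEmbed (g y, k y)) s x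

/-- **Forward pointwise energy bound of a residual trajectory** (mean-zero slices with bounded enstrophy; Poincaré
`4π²∫‖u‖² ≤ ‖∇u‖₂²`). [folklore] -/
theorem forward_energy_bound {ν : ℝ} {f : (UnitAddTorus (Fin 3)) → (EuclideanSpace ℝ (Fin 3))} {u : ℝ → (UnitAddTorus (Fin 3)) → (EuclideanSpace ℝ (Fin 3))} {p : ℝ → (UnitAddTorus (Fin 3)) → ℝ}
    (hsol : IsClassicalNSSolutionOn (Set.Ici 0) ν (fun _ => f) u p)
    (hM : ∃ M : ℝ, ∀ t : ℝ, 0 ≤ t → gradNormSq (u t) ≤ M) (hzm : ∀ t : ℝ, 0 ≤ t → HasZeroMean (u t)) :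
    ∃ C : ℝ, ∀ t : ℝ, 0 ≤ t → ∫ x, ‖u t x‖ ^ 2 ≤ C := by
  obtain ⟨M, hMt⟩ := hM
  refine ⟨M / (4 * Real.pi ^ 2), fun t ht => ?_⟩
  have hsm : IsSmooth (u t) := hsol.smooth_velocity.isSmooth_slice (Set.mem_Ici.2 ht)
  have hP := four_pi_sq_mul_integral_norm_sq_le_gradNormSq hsm (hzm t ht)
  rw [le_div_iff₀ (by positivity)]
  calc (∫ x, ‖u t x‖ ^ 2) * (4 * Real.pi ^ 2) = 4 * Real.pi ^ 2 * ∫ x, ‖u t x‖ ^ 2 := by ring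
    _ ≤ gradNormSq (u t) := hP
    _ ≤ M := hMt t ht

/-- **Dissipation floor of a residual trajectory** (the landed budget step of the line, trajectory-wise): energy
equality makes `meanDissipation` the `limsup`-mean injected power, which the planar-work sign and the contrast floor
bound below by `μ a₀`. [folklore] -/
theorem dissipation_floor {g : (UnitAddTorus (Fin 2)) → (EuclideanSpace ℝ (Fin 2))} {h : (UnitAddTorus (Fin 2)) → ℝ} {μ a₀ ν : ℝ} (hg : IsSmooth g) (hh : IsSmooth h)
    (hμ : 0 ≤ μ) {u : ℝ → (UnitAddTorus (Fin 3)) → (EuclideanSpace ℝ (Fin 3))} {p : ℝ → (UnitAddTorus (Fin 3)) → ℝ}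
    (hsol : IsClassicalNSSolutionOn (Set.Ici 0) ν (fun _ => twoHalf g (μ • h)) u p)
    (hM : ∃ M : ℝ, ∀ t : ℝ, 0 ≤ t → gradNormSq (u t) ≤ M) (hzm : ∀ t : ℝ, 0 ≤ t → HasZeroMean (u t))
    (hIg : 0 ≤ longTimeAvgInf (fun t => ∫ x, ⟪g (planarProj x), planarProjE (u t x)⟫_ℝ))
    (hIh : a₀ ≤ longTimeAvgSup (fun t => ∫ x, h (planarProj x) * u t x 2)) :
    μ * a₀ ≤ meanDissipation ν u := by
  obtain ⟨C, hC⟩ := forward_energy_bound hsol hM hzm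
  rw [meanDissipation_eq_longTimeAvgSup_inner hsol (hg.twoHalf (hh.smul μ)) hC]
  exact mul_le_longTimeAvgSup_inner_twoHalf hg hh hμ hsol.smooth_velocity hC hIg hIh

/-- **SYMMETRIC WITNESSES OF THE RESIDUAL CONTRADICT `TwohalfdNeg`.**  The negated statement is the line's residual
`ContrastFamily` RESTRICTED TO THE `2½`-DIMENSIONAL CLASS ("`ContrastFamilySymm`"): verbatim (arena force written
`twoHalf g (μ • h)` as in the landed stub files) plus the last clause, invariance of every slice `u j t` under the
vertical translations `x ↦ x + s e₂` (all `t`; values at `t < 0` are junk for a forward solution, so up to redefinition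
at negative times this is the restriction for `t ≥ 0`).  If the negative `2½`-dimensional crux `TwoAndHalfD.TwohalfdNeg`
(stmt 0211) holds, the residual has NO such witness family: such a family is an `x₂`-invariant bounded-energy global Leray–Hopf family under the
`x₂`-invariant arena force with `meanDissipation ≥ μ a₀ > 0` at every level, which `TwohalfdNeg` sends to `0`.
Contrapositive reading: an `x₂`-invariant construction of the residual refutes 0211 and proves the shape of
`TwohalfdThesis` (0206). [folklore] -/
theorem not_contrastFamilySymm_of_twohalfdNeg (hN : TwoAndHalfD.TwohalfdNeg) :
    ¬ ∃ (g : (UnitAddTorus (Fin 2)) → (EuclideanSpace ℝ (Fin 2))) (h : (UnitAddTorus (Fin 2)) → ℝ) (μ a₀ E : ℝ),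
      IsSmooth g ∧ IsDivFree g ∧ HasZeroMean g ∧ IsSmooth h ∧ HasZeroMean h ∧ 0 < μ ∧ 0 < a₀ ∧
      ∃ (ν : ℕ → ℝ) (u : ℕ → ℝ → (UnitAddTorus (Fin 3)) → (EuclideanSpace ℝ (Fin 3))) (p : ℕ → ℝ → (UnitAddTorus (Fin 3)) → ℝ),
        (∀ j, 0 < ν j) ∧ Tendsto ν atTop (nhds 0) ∧
        (∀ j, IsClassicalNSSolutionOn (Set.Ici 0) (ν j) (fun _ => twoHalf g (μ • h)) (u j) (p j)) ∧
        (∀ j, ∃ M : ℝ, ∀ t : ℝ, 0 ≤ t → gradNormSq (u j t) ≤ M) ∧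
        (∀ j t, 0 ≤ t → HasZeroMean (u j t)) ∧
        (∀ j, meanEnergy (u j) ≤ E) ∧
        (∀ j, 0 ≤ longTimeAvgInf (fun t => ∫ x, ⟪g (planarProj x), planarProjE (u j t x)⟫_ℝ)) ∧
        (∀ j, a₀ ≤ longTimeAvgSup (fun t => ∫ x, h (planarProj x) * u j t x 2)) ∧
        (∀ j (t : ℝ) (s : UnitAddCircle) (x : (UnitAddTorus (Fin 3))), u j t (x + Pi.single (2 : Fin 3) s) = u j t x) := by
  rintro ⟨g, h, μ, a₀, E, hg, hgdiv, hg0, hh, hh0, hμ, ha₀, ν, u, p, hν, hν0, hsol, hM, hzm, hE, hIg, hIh, hsymm⟩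
  -- (i) the arena force is an admissible `x₂`-invariant steady force
  have hf : IsSmooth (twoHalf g (μ • h)) := hg.twoHalf (hh.smul μ)
  have hdiv : IsDivFree (twoHalf g (μ • h)) := hgdiv.twoHalf _
  have hmean : HasZeroMean (twoHalf g (μ • h)) := hasZeroMean_twoHalf_smul hg hh hg0 hh0 μ
  -- (ii) forward classical trajectories are global Leray–Hopf solutions from `u j 0`
  have hLH : ∀ j, IsGlobalLerayHopf (ν j) (fun _ => twoHalf g (μ • h)) (u j 0) (u j) := fun j T hT =>
    (hsol j).isLerayHopfOn_of_convex (convex_Ici 0) hT Icc_subset_Ici_self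
  -- `TwohalfdNeg` evaluated on the family
  have htend : Tendsto (fun j => meanDissipation (ν j) (u j)) atTop (nhds 0) :=
    hN (twoHalf g (μ • h)) (twoHalf_add_single g (μ • h)) hf hdiv hmean ν (fun j => u j 0) u hν hν0 hLH hsymm
      ⟨E, hE⟩
  -- (iii) but every level dissipates at least `μ a₀ > 0`
  have hfloor : ∀ j, μ * a₀ ≤ meanDissipation (ν j) (u j) := fun j =>
    dissipation_floor hg hh hμ.le (hsol j) (hM j) (hzm j) (hIg j) (hIh j)
  exact not_tendsto_zero_of_le (mul_pos hμ ha₀) hfloor htend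

end Summit.AnomalousDissipation.AnomalousDissipation.Theorems.ChainRealisation.Negative

end
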